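import Mathlib.Combinatorics.Additive.AP.Three.Behrend
import Mathlib.Data.ZMod.Basic
import HarnessLib

/-!
# Salem–Spencer sets in `ℤ/M` (Alman–Duan–Vassilevska Williams–Xu–Xu–Zhou 2025, Thm. 3.7) — proved

Topic `Literature/Computability/AlgebraicComplexity`.  The hashing step of every laser-method
analysis since Coppersmith–Winograd (1990, §6) uses a large subset of `ℤ_M` without non-trivial
three-term arithmetic progressions *modulo `M`*.  Alman–Duan–Vassilevska Williams–Xu–Xu–Zhou,
SODA 2025 = arXiv:2404.16349, §3.11, **Theorem 3.7** ([Salem–Spencer 1942], [Behrend 1946]):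

> For every positive integer `M` there exists `B ⊆ ℤ_M` of size `|B| ≥ M · e^{-O(√log M)} = M^{1-o(1)}`
> that contains no nontrivial `3`-term arithmetic progression: any `a, b, c ∈ B` satisfy
> `a + b ≡ 2c (mod M)` if and only if `a = b = c`.

PROVED here with an explicit constant, from Mathlib's form of Behrend's construction
(`Behrend.roth_lower_bound : N · e^{-4 √log N} ≤ rothNumberNat N`): a progression-free
`t ⊆ {0, …, ⌈M/2⌉ - 1}` of size `rothNumberNat ⌈M/2⌉`, read in `ℤ/M`, has no wrap-around
(`a + b, 2c ≤ 2⌈M/2⌉ - 2 < M`), so `a + b ≡ 2c (mod M)` forces `a + b = 2c` in `ℕ` and `a = b = c`: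

* `advxxz2025_thm37` — for every `M ≥ 1` there is `B : Finset (ZMod M)` with
  `(M/2) · e^{-4 √(log M)} ≤ |B|` and `a + b = c + c → a = c ∧ b = c` on `B`;
* `advxxz2025_thm37_iff` — the printed "if and only if" form.

(`(M/2) e^{-4√log M} = M e^{-(4 √log M + log 2)}` is of the printed shape `M e^{-O(√log M)}`.)
The tree's `LaserHashing.exists_zeroSum_diagonal` is the same construction packaged as the diagonal
`{(s, s, -2s)}` consumed by the Bürgisser–Clausen–Shokrollahi hashing theorem; the present file
records the set-theoretic statement as printed.  No definitions, no named facts.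

## References

* J. Alman, R. Duan, V. Vassilevska Williams, Y. Xu, Z. Xu, R. Zhou, *More asymmetry yields faster
  matrix multiplication*, SODA 2025 = arXiv:2404.16349, §3.11, Thm. 3.7.
  [AlmanDuanVassilevskaWilliamsXuXuZhou2025]
* R. Salem, D. C. Spencer, *On sets of integers which contain no three terms in arithmetical
  progression*, Proc. Nat. Acad. Sci. USA 28 (1942) 561–563.
* F. A. Behrend, *On sets of integers which contain no three terms in arithmetical progression*,
  Proc. Nat. Acad. Sci. USA 32 (1946) 331–332 (Mathlib: `Mathlib.Combinatorics.Additive.AP.Three.Behrend`).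
* D. Coppersmith, S. Winograd, *Matrix multiplication via arithmetic progressions*, J. Symbolic
  Comput. 9 (1990) 251–280, §6 ("Salem–Spencer theorem"). [CoppersmithWinograd1990]
-/

noncomputable section

open Finset Real

namespace Literature.Computability.AlgebraicComplexity

/-- Casting naturals `< M` into `ZMod M` is injective. [folklore] -/
theorem zmod_natCast_eq_natCast_iff_of_lt {M a b : ℕ} (ha : a < M) (hb : b < M) :
    ((a : ZMod M) = b ↔ a = b) := by
  rw [ZMod.natCast_eq_natCast_iff', Nat.mod_eq_of_lt ha, Nat.mod_eq_of_lt hb]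

/-- The explicit size bound: for `M ≥ 1` and `k = ⌈M/2⌉`,
`(M/2) · e^{-4 √(log M)} ≤ k · e^{-4 √(log k)} ≤ rothNumberNat k`. [cite: AlmanDuanVassilevskaWilliamsXuXuZhou2025, Thm. 3.7] -/
theorem half_mul_exp_le_rothNumberNat_half {M : ℕ} (hM : 0 < M) :
    (M : ℝ) / 2 * Real.exp (-4 * Real.sqrt (Real.log M)) ≤ rothNumberNat ((M + 1) / 2) := by
  set k := (M + 1) / 2 with hk
  have hk0 : 0 < k := by omega
  have hkM : k ≤ M := by omega
  have hMk : M ≤ 2 * k := by omega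
  have hk0' : (0 : ℝ) < k := by exact_mod_cast hk0
  refine le_trans ?_ (Behrend.roth_lower_bound (N := k))
  refine mul_le_mul ?_ ?_ (Real.exp_pos _).le (Nat.cast_nonneg _)
  · have : (M : ℝ) ≤ 2 * k := by exact_mod_cast hMk
    linarith
  · refine Real.exp_le_exp.2 ?_
    have hlog : Real.log k ≤ Real.log M :=
      Real.log_le_log hk0' (by exact_mod_cast hkM)
    have := Real.sqrt_le_sqrt hlog
    linarith

/-- **Salem–Spencer / Behrend set in `ℤ/M`** (ADVXXZ Thm. 3.7, explicit form): for every `M ≥ 1`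
there is `B ⊆ ℤ/M` with `|B| ≥ (M/2) e^{-4√(log M)}` (`= M e^{-O(√log M)} = M^{1-o(1)}`) such that
`a + b = c + c` with `a, b, c ∈ B` forces `a = c` and `b = c` (no non-trivial three-term arithmetic
progression modulo `M`). [cite: AlmanDuanVassilevskaWilliamsXuXuZhou2025, Thm. 3.7] -/
theorem advxxz2025_thm37 (M : ℕ) [NeZero M] :
    ∃ B : Finset (ZMod M),
      (M : ℝ) / 2 * Real.exp (-4 * Real.sqrt (Real.log M)) ≤ B.card ∧
      ∀ a ∈ B, ∀ b ∈ B, ∀ c ∈ B, a + b = c + c → a = c ∧ b = c := by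
  have hM : 0 < M := Nat.pos_of_ne_zero (NeZero.ne M)
  set k := (M + 1) / 2 with hk
  have h2k : 2 * k ≤ M + 1 := by omega
  obtain ⟨t, htk, htcard, hfree⟩ := rothNumberNat_spec k
  have htlt : ∀ a ∈ t, a < k := fun a ha => mem_range.1 (htk ha)
  have htM : ∀ a ∈ t, a < M := fun a ha => by have := htlt a ha; omega
  refine ⟨t.image (Nat.cast : ℕ → ZMod M), ?_, ?_⟩
  · -- size
    rw [card_image_of_injOn fun a ha b hb h =>
      (zmod_natCast_eq_natCast_iff_of_lt (htM a ha) (htM b hb)).1 h, htcard]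
    exact half_mul_exp_le_rothNumberNat_half hM
  · -- no non-trivial progressions: no wrap-around, then `ThreeAPFree`
    intro x hx y hy z hz hxyz
    obtain ⟨a, ha, rfl⟩ := mem_image.1 hx
    obtain ⟨b, hb, rfl⟩ := mem_image.1 hy
    obtain ⟨c, hc, rfl⟩ := mem_image.1 hz
    have hab : a + b < M := by have := htlt a ha; have := htlt b hb; omega
    have hcc : c + c < M := by have := htlt c hc; omega
    have hnat : a + b = c + c := by
      rw [← Nat.cast_add, ← Nat.cast_add, zmod_natCast_eq_natCast_iff_of_lt hab hcc] at hxyz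
      exact hxyz
    have hac : a = c := hfree ha hc hb hnat
    subst hac
    have hba : b = a := by omega
    subst hba
    exact ⟨rfl, rfl⟩

/-- **ADVXXZ Thm. 3.7, printed form**: for every `M ≥ 1` there is `B ⊆ ℤ/M`,
`|B| ≥ (M/2) e^{-4√(log M)}`, such that `a, b, c ∈ B` satisfy `a + b = 2c` (in `ℤ/M`, i.e.
`a + b ≡ 2c (mod M)`) if and only if `a = b = c`. [cite: AlmanDuanVassilevskaWilliamsXuXuZhou2025, Thm. 3.7] -/
theorem advxxz2025_thm37_iff (M : ℕ) [NeZero M] :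
    ∃ B : Finset (ZMod M),
      (M : ℝ) / 2 * Real.exp (-4 * Real.sqrt (Real.log M)) ≤ B.card ∧
      ∀ a ∈ B, ∀ b ∈ B, ∀ c ∈ B, (a + b = 2 * c ↔ a = b ∧ b = c) := by
  obtain ⟨B, hcard, hB⟩ := advxxz2025_thm37 M
  refine ⟨B, hcard, fun a ha b hb c hc => ⟨fun h => ?_, ?_⟩⟩
  · obtain ⟨hac, hbc⟩ := hB a ha b hb c hc (by rw [h, two_mul])
    exact ⟨hac.trans hbc.symm, hbc⟩
  · rintro ⟨rfl, rfl⟩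
    rw [two_mul]

end Literature.Computability.AlgebraicComplexity

end
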